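import Mathlib
import Summits.ValiantsHypothesis.ValiantsHypothesis.Theorems.BarrierLeverPartitionMinorsHitByVPHiddenStatesBall
import Summits.ValiantsHypothesis.ValiantsHypothesis.Theorems.BarrierLeverPartitionMinorsHitByVPHiddenStatesSplitRule

/-!
# Route BarrierLever — item `PartitionMinorsHitByVP` (stmt-ValiantsHypothesis-19717):
# Conjecture Q\* in the radius-one regime via the split rule (affinely independent hidden families are universal)

Helper file (`--supports stmt-ValiantsHypothesis-19717`; cell valiant-natproofs, rung V4, 𝒟-side of door (c); prover seat
val-np-p3 gen 7). Definition-free. Closes NO item.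

* `exists_flat_of_card_le_one` — for distinct hidden sets of size `≤ 1` (the points `0, e_q`: affinely independent) EVERY
  set of columns is an exact hyperplane section, with an explicit `0/±1` functional.
* **`symbGood_of_card_le_one`** — every injective column family is symbolically good against every injective hidden family of
  sets of size `≤ 1`: induction on the number of rows by the SPLIT RULE (`…HiddenStatesSplitRule.symbGood_of_split`), splitting
  the columns at any coordinate that separates two of them.
* `ballGood_of_symbGood`, `card_le_one_of_threshold`, **`ballGood_of_le_succ`** — Conjecture Q\* (`HiddenStates.BallGood`)
  holds for all `r ≤ K + 1`; `partitionMinor_hit_of_le_sq_succ` — every layout of size `r ≤ h·h + 1` is hit inside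
  `SmallCircuits ℂ (h+h) 6` through the hidden-state door with `K = h·h`.

This is the trivial regime of Q\* (generic points); its value is that the chain door ← `BallGood` ← `SymbGood` ← split rule
← flats now runs end-to-end in the kernel, so that a proof of Q\* reduces to exhibiting split certificates (seat census:
they exist for every family at `h = 4` and every sampled family at `h = 5, 6`).

WHAT THIS IS NOT: no layout beyond the sparse-witness range is newly hit; Q\* and item 19717 stay open; nothing on CPM,
crux 14610 or VP ≠ VNP.
-/

set_option linter.dupNamespace false

namespace Summit.ValiantsHypothesis.ValiantsHypothesis.Theorems.BarrierLever.HiddenStates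

open Finset Matrix MvPolynomial

noncomputable section

variable {K h : ℕ}

/-! ## 4. Universality in the radius-one regime (hidden sets of size ≤ 1) -/

section Simplex

/-- A flat functional for hidden families of sets of size `≤ 1`: given a set `C₀` of columns, the constants
`c₀ = [no column of C₀ is ∅]`, `c q = [no column of C₀ is {q}] − c₀` make `φ(e k) = c₀ + Σ_{q ∈ e k} c q` vanish exactly
on `C₀` (injective `e`, `|e k| ≤ 1`). -/
theorem exists_flat_of_card_le_one {n : Type*} [Fintype n] [DecidableEq n] (e : n → Finset (Fin K))
    (he : Function.Injective e) (hcard : ∀ k, (e k).card ≤ 1) (C₀ : Finset n) :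
    ∃ (c₀ : ℂ) (c : Fin K → ℂ), ∀ k, (c₀ + ∑ q ∈ e k, c q = 0 ↔ k ∈ C₀) := by
  classical
  refine ⟨if ∃ k ∈ C₀, e k = ∅ then 0 else 1,
    fun q => (if ∃ k ∈ C₀, e k = {q} then 0 else 1) - (if ∃ k ∈ C₀, e k = ∅ then 0 else 1), fun k => ?_⟩
  have hk01 : (e k).card = 0 ∨ (e k).card = 1 := by have := hcard k; omega
  rcases hk01 with hk0 | hk1
  · -- `e k = ∅`
    have hk : e k = ∅ := Finset.card_eq_zero.mp hk0
    rw [hk, Finset.sum_empty, add_zero]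
    constructor
    · intro h0
      by_contra hkC
      rw [if_neg] at h0
      · exact one_ne_zero h0
      · rintro ⟨k', hk'C, hk'⟩
        exact hkC (he (hk'.trans hk.symm) ▸ hk'C)
    · intro hkC
      rw [if_pos ⟨k, hkC, hk⟩]
  · -- `e k = {q}`
    obtain ⟨q, hk⟩ := Finset.card_eq_one.mp hk1
    rw [hk, Finset.sum_singleton, add_sub_cancel]
    constructor
    · intro h0
      by_contra hkC
      rw [if_neg] at h0
      · exact one_ne_zero h0
      · rintro ⟨k', hk'C, hk'⟩
        exact hkC (he (hk'.trans hk.symm) ▸ hk'C)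
    · intro hkC
      rw [if_pos ⟨k, hkC, hk⟩]

/-- **Universality of affinely independent (radius-one) hidden families.** If the hidden sets `e k` are distinct and of
size `≤ 1` (the sub-family `{∅} ∪ {{q}}` of the ball — affinely independent points), then EVERY injective column family
`u` is symbolically good against `e`. Proof: induction on the number of rows by the split rule — any coordinate `a`
separating two columns, any set `C₀` of the right number of hidden sets (every subset of an affinely independent set is
a flat, `exists_flat_of_card_le_one`). -/
theorem symbGood_of_card_le_one {n : Type*} [Fintype n] [DecidableEq n] (u : n → Finset (Fin h))
    (hu : Function.Injective u) (e : n → Finset (Fin K)) (he : Function.Injective e)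
    (hcard : ∀ k, (e k).card ≤ 1) : SymbGood u e := by
  classical
  -- strong induction on the number of rows, over all index types
  suffices H : ∀ (m : ℕ) (n : Type) [Fintype n] [DecidableEq n], Fintype.card n = m →
      ∀ (u : n → Finset (Fin h)) (e : n → Finset (Fin K)), Function.Injective u → Function.Injective e →
        (∀ k, (e k).card ≤ 1) → SymbGood u e by
    -- transport along `Fintype.equivFin`-free universe juggling: reindex by an equivalence with a `Type`
    let ε := Fintype.equivFin n
    have hmain := H (Fintype.card n) (Fin (Fintype.card n)) (by simp) (u ∘ ε.symm) (e ∘ ε.symm)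
      (hu.comp ε.symm.injective) (he.comp ε.symm.injective) (fun k => hcard _)
    intro hzero
    apply hmain
    have hre : symbAdd (u ∘ ε.symm) (e ∘ ε.symm) = (symbAdd u e).submatrix ε.symm ε.symm := by
      refine Matrix.ext fun i k => ?_
      simp only [symbAdd, Matrix.of_apply, Matrix.submatrix_apply, Function.comp]
    unfold SymbGood at *
    rw [hre, Matrix.det_submatrix_equiv_self, hzero]
  intro m
  induction m using Nat.strong_induction_on with
  | _ m ih =>
    intro n _ _ hn u e hu he hcard
    by_cases hsub : Subsingleton n
    · exact symbGood_of_subsingleton u e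
    -- two distinct rows and a separating coordinate
    obtain ⟨i, j, hij⟩ : ∃ i j : n, i ≠ j := by
      by_contra hno
      push Not at hno
      exact hsub ⟨hno⟩
    have huij : u i ≠ u j := fun h' => hij (hu h')
    obtain ⟨i₁, j₀, a, hai, haj⟩ : ∃ i₁ j₀ : n, ∃ a : Fin h, a ∈ u i₁ ∧ a ∉ u j₀ := by
      by_cases hsub' : u i ⊆ u j
      · have : ¬ u j ⊆ u i := fun h' => huij (Finset.Subset.antisymm hsub' h')
        obtain ⟨a, ha, hna⟩ := Finset.not_subset.mp this
        exact ⟨j, i, a, ha, hna⟩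
      · obtain ⟨a, ha, hna⟩ := Finset.not_subset.mp hsub'
        exact ⟨i, j, a, ha, hna⟩
    -- sizes of the two row blocks
    have hcard₀ : Fintype.card {i // a ∉ u i} < m := by
      rw [← hn]
      exact Fintype.card_subtype_lt fun h' => h' hai
    have hcard₁ : Fintype.card {i // a ∈ u i} < m := by
      rw [← hn]
      exact Fintype.card_subtype_lt (x := j₀) haj
    -- a column set of the right size, cut out exactly by a flat functional
    obtain ⟨C₀, -, hC₀⟩ := Finset.exists_subset_card_eq
      (show Fintype.card {i // a ∉ u i} ≤ (Finset.univ : Finset n).card from by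
        rw [Finset.card_univ]; exact Fintype.card_subtype_le _)
    obtain ⟨c₀, c, hφ⟩ := exists_flat_of_card_le_one e he hcard C₀
    have hcardφ : Fintype.card {k // c₀ + ∑ q ∈ e k, c q = 0} = Fintype.card {i // a ∉ u i} := by
      rw [← hC₀, ← Fintype.card_coe]
      exact Fintype.card_congr (Equiv.subtypeEquivRight fun k => hφ k)
    have hcardφ' : Fintype.card {k // c₀ + ∑ q ∈ e k, c q ≠ 0} = Fintype.card {i // a ∈ u i} := by
      have h1 : Fintype.card {k // ¬ (c₀ + ∑ q ∈ e k, c q = 0)} =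
          Fintype.card n - Fintype.card {k // c₀ + ∑ q ∈ e k, c q = 0} := Fintype.card_subtype_compl _
      have h2 : Fintype.card {i // ¬ (a ∈ u i)} = Fintype.card n - Fintype.card {i // a ∈ u i} :=
        Fintype.card_subtype_compl _
      have h3 : Fintype.card {i // a ∈ u i} ≤ Fintype.card n := Fintype.card_subtype_le _
      show Fintype.card {k // ¬ (c₀ + ∑ q ∈ e k, c q = 0)} = _
      rw [h1, hcardφ, h2]; omega
    let κ₀ : {i // a ∉ u i} ≃ {k // c₀ + ∑ q ∈ e k, c q = 0} := Fintype.equivOfCardEq hcardφ.symm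
    let κ₁ : {i // a ∈ u i} ≃ {k // c₀ + ∑ q ∈ e k, c q ≠ 0} := Fintype.equivOfCardEq hcardφ'.symm
    refine symbGood_of_split u e a c₀ c κ₁ κ₀ ?_ ?_
    · -- rows containing `a`, with `a` erased
      refine ih _ hcard₁ {i // a ∈ u i} rfl _ _ ?_ ?_ fun k => hcard _
      · intro x y hxy
        apply Subtype.ext
        apply hu
        have := congrArg (insert a) hxy
        simp only [Finset.insert_erase x.2, Finset.insert_erase y.2] at this
        exact this
      · exact he.comp (Subtype.val_injective.comp κ₁.injective)
    · -- rows avoiding `a`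
      refine ih _ hcard₀ {i // a ∉ u i} rfl _ _ ?_ ?_ fun k => hcard _
      · exact hu.comp Subtype.val_injective
      · exact he.comp (Subtype.val_injective.comp κ₀.injective)

end Simplex

/-! ## 5. Consequences for `BallGood` and the item's matrix -/

section Ball

/-- **`BallGood` from symbolic goodness**: if `u` is symbolically good against every injective threshold (ball–colex)
enumeration `e`, then `BallGood h K r u`. -/
theorem ballGood_of_symbGood (h K r : ℕ) (u : Fin r → Finset (Fin h))
    (H : ∀ e : Fin r → Finset (Fin K), Function.Injective e →
      (∀ J, J ∉ Set.range e → ∀ i, ∑ k ∈ e i, ballWt K k < ∑ k ∈ J, ballWt K k) → SymbGood u e) :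
    BallGood h K r u := by
  intro e he hthr
  exact exists_table_of_symbGood u e (H e he hthr)

/-- In the radius-one regime `r ≤ K + 1` every member of a ball–colex threshold family has at most one element
(a set with two states is heavier than each of the `K + 1` sets of size `≤ 1`, which cannot all be in the range). -/
theorem card_le_one_of_threshold (K r : ℕ) (hr : r ≤ K + 1) (e : Fin r → Finset (Fin K))
    (hthr : ∀ J, J ∉ Set.range e → ∀ i, ∑ k ∈ e i, ballWt K k < ∑ k ∈ J, ballWt K k) (k₀ : Fin r) :
    (e k₀).card ≤ 1 := by
  classical
  by_contra hbig
  push Not at hbig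
  -- the `K + 1` light sets `∅`, `{q}`
  let f : Option (Fin K) → Finset (Fin K) := fun o => Option.elim o ∅ fun q => {q}
  have hf : Function.Injective f := by
    intro o o' hoo'
    cases o with
    | none => cases o' with
      | none => rfl
      | some q' => exact absurd hoo'.symm (Finset.singleton_ne_empty q')
    | some q => cases o' with
      | none => exact absurd hoo' (Finset.singleton_ne_empty q)
      | some q' => exact congrArg some (Finset.singleton_injective hoo')
  have hfcard : ∀ o, (f o).card ≤ 1 := by
    intro o; cases o with
    | none => simp [f]
    | some q => simp [f]
  -- each light set is lighter than `e k₀`, hence in the range of `e`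
  have hlight : ∀ o, ∑ k ∈ f o, ballWt K k < ∑ k ∈ e k₀, ballWt K k := by
    intro o
    have hub : ∑ k ∈ f o, ballWt K k < 2 * 2 ^ K := by
      rw [sum_ballWt]
      have h1 := sum_two_pow_lt K (f o)
      have h2 : (f o).card * 2 ^ K ≤ 1 * 2 ^ K := Nat.mul_le_mul_right _ (hfcard o)
      omega
    have hlb : 2 * 2 ^ K ≤ ∑ k ∈ e k₀, ballWt K k := by
      rw [sum_ballWt]
      have : 2 * 2 ^ K ≤ (e k₀).card * 2 ^ K := Nat.mul_le_mul_right _ hbig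
      omega
    omega
  have hrange : ∀ o, f o ∈ Set.range e := by
    intro o
    by_contra hno
    exact absurd (hthr (f o) hno k₀) (not_lt.mpr (hlight o).le)
  choose g hg using hrange
  have hg_inj : Function.Injective g := fun o o' hoo' => hf (by rw [← hg o, ← hg o', hoo'])
  have hg_ne : ∀ o, g o ≠ k₀ := by
    intro o ho
    have := hfcard o
    rw [← hg o, ho] at this
    omega
  -- an injection `Option (Fin K) ↪ {k // k ≠ k₀}` contradicts `r ≤ K + 1`
  have hle := Fintype.card_le_of_injective (fun o => (⟨g o, hg_ne o⟩ : {k : Fin r // k ≠ k₀}))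
    (fun o o' hoo' => hg_inj (congrArg Subtype.val hoo'))
  rw [Fintype.card_option, Fintype.card_fin, Fintype.card_subtype_compl, Fintype.card_fin,
    Fintype.card_unique] at hle
  omega

/-- **Conjecture Q\* in the radius-one regime.** For `r ≤ K + 1` every injective family is `BallGood h K r`
(kernel instance of the split-rule calculus; the regime itself is elementary — generic points). -/
theorem ballGood_of_le_succ (h K r : ℕ) (hr : r ≤ K + 1) (u : Fin r → Finset (Fin h))
    (hu : Function.Injective u) : BallGood h K r u :=
  ballGood_of_symbGood h K r u fun e he hthr =>
    symbGood_of_card_le_one u hu e he (card_le_one_of_threshold K r hr e hthr)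

/-- **Layouts of size `r ≤ h·h + 1` are hit** inside `SmallCircuits ℂ (h+h) 6` (`h ≥ 5`), through the hidden-state door
with `K = h·h` states. (As a CLASS this is inside the sparse-witness range; it is recorded as the first end-to-end use of the
symbolic split-rule machinery: door ← `BallGood` ← `SymbGood` ← split rule.) -/
theorem partitionMinor_hit_of_le_sq_succ (h r : ℕ) (hh : 5 ≤ h) (hr : r ≤ h * h + 1)
    (u w : Fin r → Finset (Fin h)) (hu : Function.Injective u) (hw : Function.Injective w) :
    ∃ f ∈ Literature.Barriers.ValiantsHypothesis.SmallCircuits ℂ (h + h) 6,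
      (Matrix.of fun i j : Fin r => MvPolynomial.coeff
        (∑ a ∈ u i, Finsupp.single (Fin.castAdd h a) 1 +
          ∑ c ∈ w j, Finsupp.single (Fin.natAdd h c) 1) f).det ≠ 0 :=
  partitionMinor_hit_of_ballGood_pair h (h * h) r hh (Nat.le_mul_self h) le_rfl u w hu
    (ballGood_of_le_succ h (h * h) r hr u hu) (ballGood_of_le_succ h (h * h) r hr w hw)

end Ball

end

end Summit.ValiantsHypothesis.ValiantsHypothesis.Theorems.BarrierLever.HiddenStates
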